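import Literature.NumberTheory.Sieve.QuadraticRootsAllModuliPowerSavingProofs
import HarnessLib

/-!
# Roots of a quadratic congruence to all moduli: Hooley's 1963 power saving — record of the MISQUOTED single-log form (deprecated names, discharged)

**Status (verdict clean-up, 2026-08-15, third pass).**  This file used to vendor ONE named fact,
`hooley1963_quadraticRoots_allModuli_powerSaving`, rendering a one-line quotation of Hooley's
theorem with a SINGLE logarithm (`≪ x^{3/4} log x`, Dartyge–Martin 2019 §1 p. 3, below).  Its
prove seat found, and the clean-up passes re-verified (page image of the original, Acta Math. 110
(1963), p. 110, Project Euclid scan; the notation `A(h)` is fixed on p. 99: "constants that depend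
at most on `h` and `a` (or `D`)"), that Hooley's THEOREM 1 prints the SQUARE of the logarithm:

> THEOREM 1. Let `D` be any fixed integer that is not a perfect square, and let
> `R(h, x) = ∑_{k ≤ x} ∑_{ν² ≡ D (mod k), 0 < ν ≤ k} e^{2πihν/k}`.  Then, for `h ≠ 0`,
> `R(h, x) = O{|h|^{4/5} σ²_{−1/2}(h) log² x} + O{σ²_{−1/2}(h) x^{3/4} log² x}`, and, in particular,
> `|R(h, x)| ≤ A(h) x^{3/4} log² x`.

So do the later papers quoting it — Duke–Friedlander–Iwaniec, Ann. of Math. 141 (1995), p. 424,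
(5): `∑_{n ≤ x} ρ_h(n) ≪ x^{3/4}(log x)²` (held copy re-read 2026-08-15, third pass), and
Bull. Lond. Math. Soc. 2021 (arXiv:2107.13301), (1.1): `𝒲_h(x, 1) ≪_h x^{3/4}(log x)²` (idem) —
and `log²` is exactly what the method yields (Hooley's Lemma 3, p. 107, completion of the
incomplete Kloosterman sums after Weil: one `log`; Lemma 4, p. 107,
`∑_{l ≤ y} d(l){(h,l)}^{1/2} = O{y log 2y σ_{−1/2}(h)}`: the second; combined in (37)–(39), p. 109).
Hooley's paper therefore does not prove the single-log bound, and no proof of it along these lines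
is in print.  (The exponent `3/4` was later lowered to `2/3` by the spectral theory of automorphic
forms — Hejhal 1978, Bykovskiĭ 1984, Zavorotnyĭ 1984, as reported in DFI 1995 p. 424 and
Dartyge–Martin 2019 §1; such bounds would imply any `x^{3/4} log x` estimate but are different and
much deeper theorems, neither what the old declaration cited nor vendored in the tree.)

**Treatment (human ruling 2026-08-15 on mis-stated facts: restate, do not delete).**  The
statement AS PRINTED is vendored and PROVED upstream, in
`Literature/NumberTheory/Sieve/QuadraticRootsAllModuliPowerSavingProofs.lean`:
`hooley1963_quadraticRoots_allModuli_logSqSaving` / `hooley1963_quadraticRoots_allModuli_logSqSaving_holds`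
(kernel-closed: axioms `propext`, `Classical.choice`, `Quot.sound` only; that file does not import
this one).  The correction only fixes the exponent of the logarithm (`log N ↦ (log N)²`), which is
meaning-preserving for every recorded user (all of them need a power saving, or just `o(N)`), so
the OLD NAMES are kept, deprecated, and DISCHARGED:

* `hooley1963_quadraticRoots_allModuli_powerSaving` is again a genuine `def … : Prop` (a named
  fact in the sense of CONVENTIONS §4) whose body IS the corrected fact
  `hooley1963_quadraticRoots_allModuli_logSqSaving` (by name — no second copy of the statement; the
  single-log body is NOT kept: it is implied by nothing in print and was never used outside this
  file), carrying `@[deprecated hooley1963_quadraticRoots_allModuli_logSqSaving]`;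
* `hooley1963_quadraticRoots_allModuli_powerSaving_holds` is a genuine
  `theorem … : hooley1963_quadraticRoots_allModuli_powerSaving` (the canonical discharge shape,
  stating the old name literally), proved by `hooley1963_quadraticRoots_allModuli_logSqSaving_holds`,
  carrying `@[deprecated hooley1963_quadraticRoots_allModuli_logSqSaving_holds]`;
* `hooley1963_quadraticRoots_allModuli_powerSaving.isLittleO` stays a deprecated alias of
  `hooley1963_quadraticRoots_allModuli_logSqSaving.isLittleO` (the `o(N)` corollary; unconditional
  form: `isLittleO_sum_polyRootWeylSum_sq_sub`).

The two `deprecated` attributes are attached by `attribute [deprecated …]` AFTER the discharge, so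
that the discharge can state the old name literally without tripping the deprecation linter inside
this file (no `set_option linter.deprecated false` needed); every use elsewhere warns and names the
replacement.  History: the first pass (p69418) kept the single-log body under a string
`@[deprecated]` — still an undischarged cited `def … : Prop`, i.e. literature debt; the second
(p70863) replaced both names by `alias`es of the corrected declarations — correct, but then the
discharge `…_powerSaving_holds` had type `…_logSqSaving`, not literally the old name, which is not
the discharge shape the ledger records (`theorem X_holds : X`); this third pass restores that shape.
`isLittleO_rpow_three_quarters_mul_log` (proved, folklore) stays.

## The quotation originally vendored (record)

Weyl sums over the roots of `f(ν) ≡ 0 (mod d)`, summed over ALL moduli `d ≤ N`,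
`S(f, N, h) = ∑_{d ≤ N} S_f(h, d)`, `S_f(h, d) = ∑_{0 ≤ ν < d, d ∣ f(ν)} e(hν/d)`
(`Literature.NumberTheory.Sieve.polyRootWeylSum f d h`).

For a general irreducible `f` of degree `≥ 2` only Hooley's 1964 logarithmic saving is in print
(vendored and PROVED in the tree: `hooley_polyRoots_logPowerSaving_holds`).  For the special
quadratics `f = X² − D`, `D` not a square, Hooley's earlier paper (Acta Math. 110 (1963)) gives a
POWER saving, `|R(h, x)| ≤ A(h) x^{3/4} log² x` (Theorem 1, p. 110), via Weil's bound for
Kloosterman sums.  The statement formerly vendored here was the one PRINTED in Dartyge–Martin,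
*Exponential sums with reducible polynomials*, Discrete Analysis 2019:15, §1 p. 3 (vendored before
the original was available; it drops one logarithm; HAL copy re-read 2026-08-15, third pass):

> When `f(n) = n² − D` with `D` not a square, Hooley [H63] obtained (using a different method)
> the more precise bound `S(f, x, h) ≪_{f,h} x^{3/4} log x`.  The exponent `3/4` in this result
> was improved to `2/3` via the theory of automorphic forms by Hejhal [He78], Bykovski [B84],
> and Zavorotny [Z84].

(`S(f, x, h)` is Dartyge–Martin's (1.1): `∑_{n ≤ x} ∑_{r mod n, f(r) ≡ 0 (mod n)} e(hr/n)`, `h ≠ 0`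
fixed, cf. the docstring of `hooley_polyRoots_logPowerSaving`.)  In Lean it read
`∀ D, ¬IsSquare D → ∀ h ≠ 0, (fun N ↦ ∑ d ∈ Icc 1 N, polyRootWeylSum (X ^ 2 - C D) d h) =O[atTop]
fun N ↦ (N : ℝ) ^ (3/4 : ℝ) * Real.log N` — the corrected declaration has `Real.log N ^ 2`.
`ν = k` and `ν = 0` contribute the same term `1`, so Hooley's range `0 < ν ≤ k` and the tree's
`0 ≤ ν < k` agree.

Use (grounding, recorded when the fact was vendored): the `k = 1`, fixed-frequency, all-moduli
rung under `Summit.Parity.BatemanHorn.Theses.TwoCMLines.QuarticRootsPowerSaving` (power saving for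
the roots of the PRODUCT `(X²+1)(X²+3)`, not in print) and under
`Summit.Parity.BatemanHorn.Theses.TwoCMLines.QuarticRootsEquidistribution`; both factors
`X² + 1 = X² − (−1)` and `X² + 3 = X² − (−3)` are instances (`D = −1, −3` are not squares).  Every
such use needs only a power saving, which the proved `log²` form supplies
(`hooley1963_quadraticRoots_allModuli_logSqSaving_holds`, `isLittleO_sum_polyRootWeylSum_sq_sub`).
No Lean file uses the old names (checked 2026-08-15, third pass); new code uses the `logSqSaving`
names.

## References

* C. Hooley, *On the number of divisors of quadratic polynomials*, Acta Math. 110 (1963), 97–114: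
  Theorem 1 p. 110; §2 p. 99 (conventions); Lemmata 3–4 p. 107; (37)–(39) p. 109.
  [cite: Hooley1963, Theorem 1 (p. 110)] — the source of record, printing `log² x`.
* W. Duke, J. B. Friedlander, H. Iwaniec, Ann. of Math. (2) 141 (1995), p. 424, (5).
  [cite: DukeFriedlanderIwaniec1995, p. 424 (5)] — quotes `x^{3/4}(log x)²`.
* C. Dartyge, G. Martin, Discrete Analysis 2019:15, §1 p. 3. [cite: DartygeMartin2019, §1 p. 3] —
  the single-log quotation formerly vendored here.
-/

namespace Literature.NumberTheory.Sieve

open scoped BigOperators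
open Filter Asymptotics Polynomial

/-- **Deprecated (verdict clean-up 2026-08-15) — the old name of a MIS-STATED fact, kept (human
ruling: restate, do not delete) as a name for the corrected, PROVED statement
`hooley1963_quadraticRoots_allModuli_logSqSaving` (`QuadraticRootsAllModuliPowerSavingProofs.lean`),
which is its body.**  What was wrong: under this name the tree rendered Dartyge–Martin's one-line
quotation "Hooley (H63) obtained … `S(f, x, h) ≪_{f,h} x^{3/4} log x`" with a SINGLE logarithm,
whereas the theorem it was attributed to — Hooley, Acta Math. 110 (1963), THEOREM 1, p. 110 —
prints the SQUARE of the logarithm: "in particular, `|R(h, x)| ≤ A(h) x^{3/4} log² x`" (likewise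
DFI 1995 p. 424 (5)); Hooley's method gives `log²` (Lemmata 3–4, (37)–(39)) and no proof of the
single-log form is in print (module docstring).  The correction (`log N ↦ (log N)²` on the right
of `=O[atTop]`) is meaning-preserving for every recorded user, so the old name is kept: it now
denotes, for `D` not a square and `h ≠ 0`,
`∑_{d ≤ N} ∑_{ν mod d, ν² ≡ D (mod d)} e(hν/d) ≪_{D,h} N^{3/4} (log N)²`
(`=O[atTop]` in `N : ℕ`; inner sum = `polyRootWeylSum (X ^ 2 - C D) d h`), discharged below by
`hooley1963_quadraticRoots_allModuli_powerSaving_holds`.  Deprecated (attribute attached at the end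
of this file): use `hooley1963_quadraticRoots_allModuli_logSqSaving` in new code.
[cite: Hooley1963, Theorem 1 (p. 110)] -/
def hooley1963_quadraticRoots_allModuli_powerSaving : Prop :=
  hooley1963_quadraticRoots_allModuli_logSqSaving

/-- **Discharge of the old name**: the corrected statement behind
`hooley1963_quadraticRoots_allModuli_powerSaving` HOLDS — it is Hooley's Theorem 1 as printed,
proved in `QuadraticRootsAllModuliPowerSavingProofs.lean`
(`hooley1963_quadraticRoots_allModuli_logSqSaving_holds`, axioms `propext`, `Classical.choice`,
`Quot.sound` only).  Deprecated together with the fact it discharges: use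
`hooley1963_quadraticRoots_allModuli_logSqSaving_holds` in new code.
[cite: Hooley1963, Theorem 1 (p. 110)] -/
theorem hooley1963_quadraticRoots_allModuli_powerSaving_holds :
    hooley1963_quadraticRoots_allModuli_powerSaving :=
  hooley1963_quadraticRoots_allModuli_logSqSaving_holds

/-- `N^{3/4} log N = o(N)` along `ℕ`. [folklore] -/
theorem isLittleO_rpow_three_quarters_mul_log :
    (fun N : ℕ => (N : ℝ) ^ (3 / 4 : ℝ) * Real.log N) =o[atTop] fun N : ℕ => (N : ℝ) := by
  have h1 : (fun x : ℝ => Real.log x) =o[atTop] fun x : ℝ => x ^ (1 / 4 : ℝ) :=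
    isLittleO_log_rpow_atTop (by norm_num)
  have h2 : (fun x : ℝ => x ^ (3 / 4 : ℝ) * Real.log x) =o[atTop]
      fun x : ℝ => x ^ (3 / 4 : ℝ) * x ^ (1 / 4 : ℝ) :=
    (isBigO_refl _ _).mul_isLittleO h1
  have h3 : (fun x : ℝ => x ^ (3 / 4 : ℝ) * x ^ (1 / 4 : ℝ)) =ᶠ[atTop] fun x : ℝ => x := by
    filter_upwards [eventually_ge_atTop (0 : ℝ)] with x hx
    rw [← Real.rpow_add' hx (by norm_num)]
    norm_num
  exact (h2.trans_eventuallyEq h3).comp_tendsto tendsto_natCast_atTop_atTop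

/-- **Deprecated alias (2026-08-15)** of `hooley1963_quadraticRoots_allModuli_logSqSaving.isLittleO`:
the power saving (corrected, `log²` form) implies the qualitative statement
`∑_{d ≤ N} S_f(h, d) = o(N)` for `f = X² − D` (the quadratic case of
`hooley_polyRoots_equidistributed`).  The former corollary of the same name took the mis-stated
single-log fact as hypothesis `H`; it now takes the corrected fact (feed it
`hooley1963_quadraticRoots_allModuli_logSqSaving_holds` — or a proof of the deprecated
`hooley1963_quadraticRoots_allModuli_powerSaving`, which unfolds to it — or use the unconditional
`isLittleO_sum_polyRootWeylSum_sq_sub`). [folklore] -/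
@[deprecated hooley1963_quadraticRoots_allModuli_logSqSaving.isLittleO (since := "2026-08-15")]
alias hooley1963_quadraticRoots_allModuli_powerSaving.isLittleO :=
  hooley1963_quadraticRoots_allModuli_logSqSaving.isLittleO

/-! ### Deprecation of the old names

Attached last, so that `hooley1963_quadraticRoots_allModuli_powerSaving_holds` above can state the
old name literally (the discharge shape `theorem X_holds : X`) without a deprecation warning inside
this file; any use of either old name elsewhere warns and names its replacement. -/

attribute [deprecated hooley1963_quadraticRoots_allModuli_logSqSaving (since := "2026-08-15")]
  hooley1963_quadraticRoots_allModuli_powerSaving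

attribute [deprecated hooley1963_quadraticRoots_allModuli_logSqSaving_holds (since := "2026-08-15")]
  hooley1963_quadraticRoots_allModuli_powerSaving_holds

end Literature.NumberTheory.Sieve
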